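import Summits.ResolutionOfSingularities.ResolutionOfSingularities.Theorems.FrobeniusLadderFInjectiveMacaulayficationFiniteResidualOfFourfold
import Summits.ResolutionOfSingularities.ResolutionOfSingularities.Theorems.FrobeniusLadderFInjectiveMacaulayficationRegularOffCodimFourResidue
import HarnessLib

/-!
# ★ HOLE #3 ON 4-FOLDS COLLAPSES ONTO CLOSED-POINT ABSORPTION: FC″(loc dim ≤ 3) on 4-folds ⟸ (T3ᵃ′), modulo the Cossart–Piltant package only
# (crux `FInjectiveMacaulayfication` stmt-ResolutionOfSingularities-15315, chain w45a; res-L1-w45a-plan-1 RULINGS R16.59–R16.63 «THEOREM A»; the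
# assembly of res-L1-w45a-stub-3's U-line (U1) `RegularOffCodimFourResidue.exists_isBlowup_regular_off_codimFour` (p557070 = Temkin 2008 Prop. 2.3.4
# truncated at codimension 4 with Cossart–Piltant at dimension-3 points — THEOREM A, in the tree since 18:58Z, identified by stub-3 23:00:49Z) with
# res-L1-w45a-lead-1's `FiniteResidualOfFourfold` (p583217) and res-L1-w45a-stub-1's `fcUnguardedOfFiniteResidualR_of_absorbingStepNC` (p575338);
# seat res-L1-w45a-lead-1 g7)

[OURS · L1 W4.5a] Support file (`--supports stmt-ResolutionOfSingularities-15315 --as helper`); replaces the role of NO printed item; NOT a statement of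
the manuscript; def-free; THEOREMS modulo `CossartPiltant2019General` (CP 2019 Thm. 1.1 (i)(ii)), `Stacks081R` (Raynaud–Gruson 5.2.2) and
`CossartPiltant2019Principalization` (CP 2019 Prop. 4.4) BY NAME, and modulo the CANDIDATE step (T3ᵃ′) `AbsorbingStep.AbsorbingClosedPointStepNC`
of OURS; AI-written (AI review is weaker than expert review).

* `isClosed_singleton_of_le_ringKrullDim_stalk` — on a scheme of dimension `≤ n`, a point whose local ring has dimension `≥ n` is CLOSED
  (`height + coheight ≤ dim`, Stacks 02IZ; unconditional).
* `regularOffFinite_dimFour (hG h081R hP)` — THEOREM A ON 4-FOLDS in the shape consumed by `FiniteResidualOfFourfold`: for an integral `k`-scheme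
  `X₁` of finite type with `3 ≤ dim X₁ ≤ 4` there are ONE blowing up `f : X′ → X₁` along `J`, `supp J ⊆ Sing X₁`, and a FINITE closed set `F` of
  CLOSED points with `X′` regular off `f⁻¹F` — (U1)'s closed residue `B` (points of local dimension `≥ 4`) consists of closed points when
  `dim X₁ ≤ 4`, hence is finite.
* **`fcUnguardedLocDimLe3_dimFour_of_absorbingStepNC (h : AbsorbingClosedPointStepNC) (hG h081R hP)`** — the binders of FC″ (`FCUnguardedRungs.FCUnguardedDimGe4`
  / `FCUnguardedLocDimLe3.FCUnguardedLocDimLe3`) with `topologicalKrullDim X₁ ≤ 4` added ⇒ the conclusion of FC″ at EVERY non-closed F-bad `η`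
  (no local-dimension guard needed: on a 4-fold every non-closed point has local dimension `≤ 3`). I.e. **on 4-folds the door stub
  `stub_fcUnguardedLocDimLe3` follows from (T3ᵃ′) alone, modulo the CP package** — the TERMINATION content (i) of hole #3 is DISCHARGED (Temkin's
  Noetherian induction UPSTAIRS: each round's centre lives over the current bad set, so nothing already cured is re-blown); what remains is the
  ABSORPTION of finitely many closed residual points = the d = 4 closed core in `GoodOver` currency. `…_of_absorbingStep` for the stronger (T3ᵃ).
[folklore assembly; cite: Temkin2008, Prop. 2.3.4; CossartPiltant2019, Thm. 1.1 (i)(ii), Prop. 4.4; RaynaudGruson1971, Thm. 5.2.2;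
StacksProject, Tag 02IZ, Tag 080B]
-/

-- single-problem summit: the doubled namespace component is forced
set_option linter.dupNamespace false

noncomputable section

namespace Summit.ResolutionOfSingularities.ResolutionOfSingularities.Theorems.FInjectiveMacaulayfication.FCUnguardedDimFourOfAbsorbingStep

open CategoryTheory CategoryTheory.Limits AlgebraicGeometry TopologicalSpace IsLocalRing
open Literature.AlgebraicGeometry.Resolution
open Summit.ResolutionOfSingularities.ResolutionOfSingularities.Theorems.FInjectiveMacaulayfication
open SliceableCentre FCUnguardedAprime

/-! ## §1 Points of maximal local dimension are closed -/

/-- **On a scheme of dimension `≤ n`, a point whose local ring has dimension `≥ n` is a closed point** (`height x + coheight x ≤ dim X` forces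
`height x = 0`, i.e. `x` is minimal for specialisation). [folklore; cite: StacksProject, Tag 02IZ] -/
theorem isClosed_singleton_of_le_ringKrullDim_stalk {X : Scheme.{0}} {n : ℕ} (hX : topologicalKrullDim X ≤ n)
    {b : X} (hb : (n : WithBot ℕ∞) ≤ ringKrullDim (X.presheaf.stalk b)) : IsClosed ({b} : Set X) := by
  have hcoh : (n : ℕ∞) ≤ Order.coheight b := by
    have h := ringKrullDim_stalk_eq_coheight b
    rw [h] at hb
    exact_mod_cast hb
  have h2 : ((Order.height b + Order.coheight b : ℕ∞) : WithBot ℕ∞) ≤ n :=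
    (coe_height_add_coheight_le_topologicalKrullDim b).trans hX
  have h3 : Order.height b + Order.coheight b ≤ n := by exact_mod_cast h2
  -- hence `height b = 0`
  have hcb : Order.coheight b ≠ ⊤ := by
    intro htop
    rw [htop, add_top] at h3
    exact absurd h3 (by simp)
  obtain ⟨m, hm⟩ := ENat.ne_top_iff_exists.mp hcb
  have hhb : Order.height b ≠ ⊤ := by
    intro htop
    rw [htop, top_add] at h3
    exact absurd h3 (by simp)
  obtain ⟨a, ha⟩ := ENat.ne_top_iff_exists.mp hhb
  rw [← hm] at hcoh h3
  rw [← ha] at h3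
  have h1' : n ≤ m := by exact_mod_cast hcoh
  have h3' : a + m ≤ n := by exact_mod_cast h3
  have ha0 : a = 0 := by omega
  have hmin : IsMin b := by
    rw [← Order.height_eq_zero, ← ha, ha0]
    rfl
  have hcl : closure ({b} : Set X) = {b} := by
    refine Set.Subset.antisymm (fun y hy => ?_) subset_closure
    have hby : b ⤳ y := specializes_iff_mem_closure.mpr hy
    have hyb : y ≤ b := Scheme.le_iff_specializes.mpr hby
    have hby' : b ≤ y := hmin hyb
    exact Set.mem_singleton_iff.mpr (Specializes.antisymm (Scheme.le_iff_specializes.mp hby') hby).eq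
  rw [← hcl]
  exact isClosed_closure

/-! ## §2 THEOREM A on 4-folds, in the shape consumed by `FiniteResidualOfFourfold` -/

/-- **THEOREM A ON 4-FOLDS** (from the U-line (U1) `exists_isBlowup_regular_off_codimFour`): an integral `k`-scheme of finite type with
`3 ≤ dim X₁ ≤ 4` has ONE blowing up along a centre supported in `Sing X₁` that is REGULAR off the preimage of a FINITE set of CLOSED points.
Modulo CP 2019 Thm. 1.1, Raynaud–Gruson and CP 2019 Prop. 4.4 BY NAME. [OURS · conditional-result]
[cite: Temkin2008, Prop. 2.3.4] [cite: CossartPiltant2019, Thm. 1.1 (i)(ii); Prop. 4.4] -/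
theorem regularOffFinite_dimFour
    (hG : CossartPiltant2019General.{0}) (h081R : Stacks081R.{0}) (hP : CossartPiltant2019Principalization.{0})
    {k : Type} [Field k] {X₁ : Scheme.{0}} (f₁ : X₁ ⟶ Spec (.of k)) [IsIntegral X₁] [LocallyOfFiniteType f₁] [QuasiCompact f₁]
    (h3 : (3 : WithBot ℕ∞) ≤ topologicalKrullDim X₁) (h4 : topologicalKrullDim X₁ ≤ 4) :
    ∃ (X' : Scheme.{0}) (f : X' ⟶ X₁) (J : X₁.IdealSheafData) (F : Set X₁), IsBlowup f J ∧
      (J.support : Set X₁) ⊆ (Scheme.regularLocus X₁)ᶜ ∧ IsClosed F ∧ F.Finite ∧ (∀ b ∈ F, IsClosed ({b} : Set X₁)) ∧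
      ∀ x' : X', f x' ∉ F → x' ∈ Scheme.regularLocus X' := by
  haveI : IsNoetherian X₁ := ClosedPointsOfClosedFinite.isNoetherian_of_locallyOfFiniteType_of_quasiCompact f₁
  obtain ⟨X', f, J, hf, hJ, B, hBcl, hBdim, hreg⟩ :=
    RegularOffCodimFourResidue.exists_isBlowup_regular_off_codimFour hG h081R hP f₁ h3
  have hBpts : ∀ b ∈ B, IsClosed ({b} : Set X₁) := fun b hb =>
    isClosed_singleton_of_le_ringKrullDim_stalk (n := 4) (by exact_mod_cast h4) (hBdim b hb)
  exact ⟨X', f, J, B, hf, hJ, hBcl,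
    ClosedPointsOfClosedFinite.finite_of_isClosed_of_forall_isClosed_singleton hBcl hBpts, hBpts,
    fun x' hx' => (Scheme.mem_regularLocus x').mpr (hreg x' hx')⟩

/-! ## §3 ★ FC″(loc dim ≤ 3) ON 4-FOLDS ⟸ (T3ᵃ′) -/

/-- **★ ON 4-FOLDS, FC″ FOLLOWS FROM THE ABSORBING CLOSED-POINT STEP (T3ᵃ′) ALONE** (modulo the Cossart–Piltant package BY NAME): the binders of
FC″ (`FCUnguardedLocDimLe3.FCUnguardedLocDimLe3` / `FCUnguardedRungs.FCUnguardedDimGe4`: integral separated `k`-scheme of finite type of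
dimension `≥ 4` with Cohen–Macaulay stalks, `η` non-closed and F-bad with F-good proper generizations) together with `topologicalKrullDim X₁ ≤ 4`
give the conclusion of FC″ at `η` — THEOREM A (U1, Temkin + CP) makes one blowing up regular off finitely many closed points of `X₁`, whence the
finite-residual hypothesis at `η` (`FiniteResidualOfFourfold`), and res-L1-w45a-stub-1's iteration of (T3ᵃ′) absorbs the residual points
(`AbsorbingStep.fcUnguardedOfFiniteResidualR_of_absorbingStepNC`). The TERMINATION content of hole #3 is thereby discharged on 4-folds.
[OURS · conditional on the CANDIDATE (T3ᵃ′) and on CP 1.1 / R–G / CP 4.4 BY NAME] [cite: Temkin2008, Prop. 2.3.4] [cite: CossartPiltant2019, Thm. 1.1; Prop. 4.4] -/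
theorem fcUnguardedLocDimLe3_dimFour_of_absorbingStepNC (h : AbsorbingStep.AbsorbingClosedPointStepNC)
    (hG : CossartPiltant2019General.{0}) (h081R : Stacks081R.{0}) (hP : CossartPiltant2019Principalization.{0})
    (p : ℕ) (hp : p.Prime) (k : Type) [Field k] [CharP k p] (X₁ : Scheme.{0}) (f₁ : X₁ ⟶ Spec (.of k))
    (hs : IsSeparated f₁) (hft : LocallyOfFiniteType f₁) (hqc : QuasiCompact f₁) (hi : IsIntegral X₁) (h4 : 4 ≤ topologicalKrullDim X₁)
    (h4' : topologicalKrullDim X₁ ≤ 4)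
    (hCM : ∀ x : X₁, (∀ d : ℕ, ringKrullDim (X₁.presheaf.stalk x) = d → ∀ s : Fin d → X₁.presheaf.stalk x,
        (Ideal.span (Set.range s)).radical.IsMaximal → RingTheory.Sequence.IsWeaklyRegular (X₁.presheaf.stalk x) (List.ofFn s)))
    (η : X₁)
    (hη : ¬ IsClosed ({η} : Set X₁) ∧ ¬ (∀ d : ℕ, ringKrullDim (X₁.presheaf.stalk η) = d → ∀ s : Fin d → X₁.presheaf.stalk η,
          (Ideal.span (Set.range s)).radical.IsMaximal → ∀ t : X₁.presheaf.stalk η, (∃ e : ℕ, t ^ p ^ e ∈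
            Ideal.span ((fun z : X₁.presheaf.stalk η => z ^ p ^ e) '' (Ideal.span (Set.range s) : Set (X₁.presheaf.stalk η)))) →
              t ∈ Ideal.span (Set.range s)) ∧
        ∀ y : X₁, y ⤳ η → y ≠ η → (∀ d : ℕ, ringKrullDim (X₁.presheaf.stalk y) = d → ∀ s : Fin d → X₁.presheaf.stalk y,
          (Ideal.span (Set.range s)).radical.IsMaximal → ∀ t : X₁.presheaf.stalk y, (∃ e : ℕ, t ^ p ^ e ∈
            Ideal.span ((fun z : X₁.presheaf.stalk y => z ^ p ^ e) '' (Ideal.span (Set.range s) : Set (X₁.presheaf.stalk y)))) →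
              t ∈ Ideal.span (Set.range s))) :
    ∃ (J : X₁.IdealSheafData) (n' : ℕ) (c' : Fin n' → X₁.presheaf.stalk η), J ≠ ⊥ ∧ η ∈ (J.support : Set X₁) ∧
      Ideal.span (Set.range c') ≠ ⊥ ∧ Ideal.span (Set.range c') ≤ maximalIdeal (X₁.presheaf.stalk η) ∧
        (∀ (j : Fin n') (𝔔 : PrimeSpectrum (blowupAlgebra (Ideal.span (Set.range c')) (c' j))),
          𝔔.asIdeal.comap (algebraMap (X₁.presheaf.stalk η) (blowupAlgebra (Ideal.span (Set.range c')) (c' j))) =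
            maximalIdeal (X₁.presheaf.stalk η) →
          IsDomain (Localization.AtPrime 𝔔.asIdeal) ∧ ∀ d : ℕ, ringKrullDim (Localization.AtPrime 𝔔.asIdeal) = d →
            ∀ s : Fin d → Localization.AtPrime 𝔔.asIdeal, (Ideal.span (Set.range s)).radical.IsMaximal →
              RingTheory.Sequence.IsWeaklyRegular (Localization.AtPrime 𝔔.asIdeal) (List.ofFn s) ∧
              ∀ y : Localization.AtPrime 𝔔.asIdeal, (∃ e : ℕ, y ^ p ^ e ∈ Ideal.span ((fun z : Localization.AtPrime 𝔔.asIdeal => z ^ p ^ e) ''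
                (Ideal.span (Set.range s) : Set (Localization.AtPrime 𝔔.asIdeal)))) → y ∈ Ideal.span (Set.range s)) ∧
      stalkIdeal J η = Ideal.span (Set.range c') ∧
      (∀ (X₂ : Scheme.{0}) (π : X₂ ⟶ X₁), IsBlowup π J →
        (∀ x : X₂, π.base x ∈ (J.support : Set X₁) → π.base x ≠ η → ¬ IsClosed ({x} : Set X₂) →
          IsDomain (X₂.presheaf.stalk x) ∧ ∀ d : ℕ, ringKrullDim (X₂.presheaf.stalk x) = d → ∀ s : Fin d → X₂.presheaf.stalk x,
            (Ideal.span (Set.range s)).radical.IsMaximal → RingTheory.Sequence.IsWeaklyRegular (X₂.presheaf.stalk x) (List.ofFn s) ∧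
            ∀ t : X₂.presheaf.stalk x, (∃ e : ℕ, t ^ p ^ e ∈ Ideal.span ((fun z : X₂.presheaf.stalk x => z ^ p ^ e) ''
              (Ideal.span (Set.range s) : Set (X₂.presheaf.stalk x)))) → t ∈ Ideal.span (Set.range s)) ∧
        (∀ x : X₂, π.base x ∈ (J.support : Set X₁) → IsClosed ({x} : Set X₂) →
          ∀ d : ℕ, ringKrullDim (X₂.presheaf.stalk x) = d → ∀ s : Fin d → X₂.presheaf.stalk x,
            (Ideal.span (Set.range s)).radical.IsMaximal → RingTheory.Sequence.IsWeaklyRegular (X₂.presheaf.stalk x) (List.ofFn s))) := by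
  haveI := hft
  haveI := hqc
  haveI := hi
  have h3 : (3 : WithBot ℕ∞) ≤ topologicalKrullDim X₁ := le_trans (by exact_mod_cast (by norm_num : (3 : ℕ) ≤ 4)) h4
  exact FiniteResidualOfFourfold.fcUnguarded_of_absorbingStepNC_of_regularOffFinite h p hp k X₁ f₁ hs hft hqc hi h4 hCM
    (regularOffFinite_dimFour hG h081R hP f₁ h3 h4') η hη

/-- The same modulo the stronger step (T3ᵃ) `AbsorbingClosedPointStep` of record (R16.36). [OURS · conditional on the CANDIDATE (T3ᵃ) and on the
CP package BY NAME] -/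
theorem fcUnguardedLocDimLe3_dimFour_of_absorbingStep (h : AbsorbingStep.AbsorbingClosedPointStep)
    (hG : CossartPiltant2019General.{0}) (h081R : Stacks081R.{0}) (hP : CossartPiltant2019Principalization.{0})
    (p : ℕ) (hp : p.Prime) (k : Type) [Field k] [CharP k p] (X₁ : Scheme.{0}) (f₁ : X₁ ⟶ Spec (.of k))
    (hs : IsSeparated f₁) (hft : LocallyOfFiniteType f₁) (hqc : QuasiCompact f₁) (hi : IsIntegral X₁) (h4 : 4 ≤ topologicalKrullDim X₁)
    (h4' : topologicalKrullDim X₁ ≤ 4)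
    (hCM : ∀ x : X₁, (∀ d : ℕ, ringKrullDim (X₁.presheaf.stalk x) = d → ∀ s : Fin d → X₁.presheaf.stalk x,
        (Ideal.span (Set.range s)).radical.IsMaximal → RingTheory.Sequence.IsWeaklyRegular (X₁.presheaf.stalk x) (List.ofFn s)))
    (η : X₁)
    (hη : ¬ IsClosed ({η} : Set X₁) ∧ ¬ (∀ d : ℕ, ringKrullDim (X₁.presheaf.stalk η) = d → ∀ s : Fin d → X₁.presheaf.stalk η,
          (Ideal.span (Set.range s)).radical.IsMaximal → ∀ t : X₁.presheaf.stalk η, (∃ e : ℕ, t ^ p ^ e ∈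
            Ideal.span ((fun z : X₁.presheaf.stalk η => z ^ p ^ e) '' (Ideal.span (Set.range s) : Set (X₁.presheaf.stalk η)))) →
              t ∈ Ideal.span (Set.range s)) ∧
        ∀ y : X₁, y ⤳ η → y ≠ η → (∀ d : ℕ, ringKrullDim (X₁.presheaf.stalk y) = d → ∀ s : Fin d → X₁.presheaf.stalk y,
          (Ideal.span (Set.range s)).radical.IsMaximal → ∀ t : X₁.presheaf.stalk y, (∃ e : ℕ, t ^ p ^ e ∈
            Ideal.span ((fun z : X₁.presheaf.stalk y => z ^ p ^ e) '' (Ideal.span (Set.range s) : Set (X₁.presheaf.stalk y)))) →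
              t ∈ Ideal.span (Set.range s))) :
    ∃ (J : X₁.IdealSheafData) (n' : ℕ) (c' : Fin n' → X₁.presheaf.stalk η), J ≠ ⊥ ∧ η ∈ (J.support : Set X₁) ∧
      Ideal.span (Set.range c') ≠ ⊥ ∧ Ideal.span (Set.range c') ≤ maximalIdeal (X₁.presheaf.stalk η) ∧
        (∀ (j : Fin n') (𝔔 : PrimeSpectrum (blowupAlgebra (Ideal.span (Set.range c')) (c' j))),
          𝔔.asIdeal.comap (algebraMap (X₁.presheaf.stalk η) (blowupAlgebra (Ideal.span (Set.range c')) (c' j))) =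
            maximalIdeal (X₁.presheaf.stalk η) →
          IsDomain (Localization.AtPrime 𝔔.asIdeal) ∧ ∀ d : ℕ, ringKrullDim (Localization.AtPrime 𝔔.asIdeal) = d →
            ∀ s : Fin d → Localization.AtPrime 𝔔.asIdeal, (Ideal.span (Set.range s)).radical.IsMaximal →
              RingTheory.Sequence.IsWeaklyRegular (Localization.AtPrime 𝔔.asIdeal) (List.ofFn s) ∧
              ∀ y : Localization.AtPrime 𝔔.asIdeal, (∃ e : ℕ, y ^ p ^ e ∈ Ideal.span ((fun z : Localization.AtPrime 𝔔.asIdeal => z ^ p ^ e) ''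
                (Ideal.span (Set.range s) : Set (Localization.AtPrime 𝔔.asIdeal)))) → y ∈ Ideal.span (Set.range s)) ∧
      stalkIdeal J η = Ideal.span (Set.range c') ∧
      (∀ (X₂ : Scheme.{0}) (π : X₂ ⟶ X₁), IsBlowup π J →
        (∀ x : X₂, π.base x ∈ (J.support : Set X₁) → π.base x ≠ η → ¬ IsClosed ({x} : Set X₂) →
          IsDomain (X₂.presheaf.stalk x) ∧ ∀ d : ℕ, ringKrullDim (X₂.presheaf.stalk x) = d → ∀ s : Fin d → X₂.presheaf.stalk x,
            (Ideal.span (Set.range s)).radical.IsMaximal → RingTheory.Sequence.IsWeaklyRegular (X₂.presheaf.stalk x) (List.ofFn s) ∧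
            ∀ t : X₂.presheaf.stalk x, (∃ e : ℕ, t ^ p ^ e ∈ Ideal.span ((fun z : X₂.presheaf.stalk x => z ^ p ^ e) ''
              (Ideal.span (Set.range s) : Set (X₂.presheaf.stalk x)))) → t ∈ Ideal.span (Set.range s)) ∧
        (∀ x : X₂, π.base x ∈ (J.support : Set X₁) → IsClosed ({x} : Set X₂) →
          ∀ d : ℕ, ringKrullDim (X₂.presheaf.stalk x) = d → ∀ s : Fin d → X₂.presheaf.stalk x,
            (Ideal.span (Set.range s)).radical.IsMaximal → RingTheory.Sequence.IsWeaklyRegular (X₂.presheaf.stalk x) (List.ofFn s))) :=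
  fcUnguardedLocDimLe3_dimFour_of_absorbingStepNC (AbsorbingStep.absorbingStepNC_of_step h) hG h081R hP p hp k X₁ f₁ hs hft hqc hi h4 h4'
    hCM η hη

end Summit.ResolutionOfSingularities.ResolutionOfSingularities.Theorems.FInjectiveMacaulayfication.FCUnguardedDimFourOfAbsorbingStep

end
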